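import Literature.Geometry.Lorentzian.ReggeWheelerChannels

/-!
# `ChannelsResolveTameDevelopments` (stmt-FinalStateConjecture-10046, route PhotonSphereChannels) —
# negative-side lemmas I: slice calculus and the local conservation law for `1+1` waves

Standing-adversary (cdisprove) output for the crux
`Summit.FinalStateConjecture.FinalStateConjecture.Theses.PhotonSphereChannels.ChannelsResolveTameDevelopments`
`= (UniformPhotonSphereChannels → Φ)`, whose antecedent `K1` (the `ℓ`-uniform two-ended exterior
channel-of-energy inequality for the Regge–Wheeler family) is refuted on paper by horizon-side
turning-point packets.  The energy half of that refutation needs the monotonicity of the exterior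
energy (`ExteriorEnergyAntitone.lean` in this directory); this file supplies its pointwise input over
the Literature vocabulary of `ReggeWheelerChannels.lean` (`energyDensity`, `IsSolutionAt`):

* `dT`, `dX`, `d2` — first and second partials of `uncurry φ` as values of `fderiv`; for
  `φ ∈ C²(ℝ²)` (`ContDiff ℝ 2 (uncurry φ)`): the slice derivatives (`deriv_slice_t/x`,
  `iteratedDeriv_two_slice_t/x` identify Mathlib's `deriv`/`iteratedDeriv 2` of the coordinate slices,
  which is how the route items and the Literature file write the equation), and Schwarz `d2_symm`
  (`ContDiffAt.isSymmSndFDerivAt`).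
* `eDen V φ`, `flux φ` — the energy density `φ_t² + φ_x² + Vφ²` (`= energyDensity`,
  `energyDensity_eq`) and the flux `2φ_tφ_x` as functions on `ℝ²`; `abs_flux_le_eDen` (`|F| ≤ e` for
  `V ≥ 0`); `contDiff_eDen` (`C¹` for `V ∈ C¹`), `contDiff_flux`.
* `fderiv_eDen_eq_fderiv_flux` — **the local conservation law** `∂_t e = ∂_x F` for `C²` solutions of
  `φ_tt − φ_xx + Vφ = 0`, `V ∈ C¹` (directional `fderiv`s).

Refuter seat `refuter-cdisprove-stmt-FinalStateConjecture-10046-0`, 2026-08-15; companions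
`ShrinkingIntervalEnergy.lean`, `ExteriorEnergyAntitone.lean`, workfile
`Cruxes/ChannelsResolveTameDevelopments/Disproof.lean`.

## References

* C. Kenig, A. Lawrie, B. Liu, W. Schlag, Adv. Math. 285 (2015) 877–936, §1 (key `KenigEtAl2015`).
* M. Dafermos, I. Rodnianski, arXiv:0811.0354, §4.1 (energy identity) (key `DafermosRodnianski2008`).
-/

noncomputable section

open Filter Set MeasureTheory intervalIntegral
open scoped Topology ENNReal

namespace Summit.FinalStateConjecture.FinalStateConjecture.Theorems.ChannelsResolveTameDevelopments.Negative

open Literature.Geometry.Lorentzian Literature.Geometry.Lorentzian.ReggeWheeler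

/-! ### Slice calculus for `C²` functions of `(t, x)` -/

section Slices

variable {φ : ℝ → ℝ → ℝ}

/-- First partials of `uncurry φ` as directional values of `fderiv`. [folklore] -/
def dT (φ : ℝ → ℝ → ℝ) (p : ℝ × ℝ) : ℝ := fderiv ℝ (Function.uncurry φ) p (1, 0)
/-- `∂_x φ` as the value of `fderiv` of `uncurry φ` on `(0, 1)`. [folklore] -/
def dX (φ : ℝ → ℝ → ℝ) (p : ℝ × ℝ) : ℝ := fderiv ℝ (Function.uncurry φ) p (0, 1)
/-- Second partials: `d2 φ p v w = D²(uncurry φ)(p)[w][v]` realised as `fderiv (fun q ↦ fderiv _ q v) p w`. [folklore] -/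
def d2 (φ : ℝ → ℝ → ℝ) (p : ℝ × ℝ) (v w : ℝ × ℝ) : ℝ :=
  fderiv ℝ (fun q ↦ fderiv ℝ (Function.uncurry φ) q v) p w

/-- The horizontal line `τ ↦ (τ, x)` has velocity `(1, 0)`. [folklore] -/
theorem hasDerivAt_curve_t (x t : ℝ) : HasDerivAt (fun τ : ℝ ↦ ((τ, x) : ℝ × ℝ)) (1, 0) t :=
  (hasDerivAt_id t).prodMk (hasDerivAt_const t x)

/-- The vertical line `y ↦ (t, y)` has velocity `(0, 1)`. [folklore] -/
theorem hasDerivAt_curve_x (t x : ℝ) : HasDerivAt (fun y : ℝ ↦ ((t, y) : ℝ × ℝ)) (0, 1) x :=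
  (hasDerivAt_const x t).prodMk (hasDerivAt_id x)

variable (hφ : ContDiff ℝ 2 (Function.uncurry φ))
include hφ

/-- A `C²` function is differentiable. [folklore] -/
theorem differentiable_uncurry : Differentiable ℝ (Function.uncurry φ) :=
  hφ.differentiable (by norm_num)

/-- The derivative of a `C²` function is `C¹`. [folklore] -/
theorem contDiff_fderiv_uncurry : ContDiff ℝ 1 (fderiv ℝ (Function.uncurry φ)) :=
  hφ.fderiv_right (by norm_num)

/-- Directional first derivatives of a `C²` function are differentiable. [folklore] -/
theorem differentiable_fderiv_apply (v : ℝ × ℝ) :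
    Differentiable ℝ (fun q ↦ fderiv ℝ (Function.uncurry φ) q v) :=
  ((contDiff_fderiv_uncurry hφ).clm_apply contDiff_const).differentiable one_ne_zero

/-- `∂_t φ` is continuous. [folklore] -/
theorem continuous_dT : Continuous (dT φ) :=
  ((contDiff_fderiv_uncurry hφ).clm_apply contDiff_const).continuous

/-- `∂_x φ` is continuous. [folklore] -/
theorem continuous_dX : Continuous (dX φ) :=
  ((contDiff_fderiv_uncurry hφ).clm_apply contDiff_const).continuous

/-- Second partials of a `C²` function are continuous. [folklore] -/
theorem continuous_d2 (v w : ℝ × ℝ) : Continuous (fun p ↦ d2 φ p v w) := by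
  have h1 : ContDiff ℝ 1 (fun q ↦ fderiv ℝ (Function.uncurry φ) q v) :=
    (contDiff_fderiv_uncurry hφ).clm_apply contDiff_const
  have h2 : Continuous (fderiv ℝ (fun q ↦ fderiv ℝ (Function.uncurry φ) q v)) :=
    h1.continuous_fderiv (by norm_num)
  exact (h2.clm_apply continuous_const)

/-- `∂_t φ` along the `t`-slice. [folklore] -/
theorem hasDerivAt_slice_t (t x : ℝ) : HasDerivAt (fun τ ↦ φ τ x) (dT φ (t, x)) t := by
  have h := ((differentiable_uncurry hφ) (t, x)).hasFDerivAt.comp_hasDerivAt t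
    (hasDerivAt_curve_t x t)
  simpa [Function.comp_def, dT] using h

/-- `∂_x φ` along the `x`-slice. [folklore] -/
theorem hasDerivAt_slice_x (t x : ℝ) : HasDerivAt (φ t) (dX φ (t, x)) x := by
  have h := ((differentiable_uncurry hφ) (t, x)).hasFDerivAt.comp_hasDerivAt x
    (hasDerivAt_curve_x t x)
  simpa [Function.comp_def, dX] using h

/-- `deriv` of the `t`-slice is `∂_t φ`. [folklore] -/
theorem deriv_slice_t (t x : ℝ) : deriv (fun τ ↦ φ τ x) t = dT φ (t, x) :=
  (hasDerivAt_slice_t hφ t x).deriv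

/-- `deriv` of the `x`-slice is `∂_x φ`. [folklore] -/
theorem deriv_slice_x (t x : ℝ) : deriv (φ t) x = dX φ (t, x) :=
  (hasDerivAt_slice_x hφ t x).deriv

/-- Second slice derivatives. [folklore] -/
theorem hasDerivAt_dT_t (t x : ℝ) :
    HasDerivAt (fun τ ↦ dT φ (τ, x)) (d2 φ (t, x) (1, 0) (1, 0)) t := by
  have h := ((differentiable_fderiv_apply hφ (1, 0)) (t, x)).hasFDerivAt.comp_hasDerivAt t
    (hasDerivAt_curve_t x t)
  simpa [Function.comp_def, dT, d2] using h

/-- `∂_x ∂_t φ` along the `x`-slice. [folklore] -/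
theorem hasDerivAt_dT_x (t x : ℝ) :
    HasDerivAt (fun y ↦ dT φ (t, y)) (d2 φ (t, x) (1, 0) (0, 1)) x := by
  have h := ((differentiable_fderiv_apply hφ (1, 0)) (t, x)).hasFDerivAt.comp_hasDerivAt x
    (hasDerivAt_curve_x t x)
  simpa [Function.comp_def, dT, d2] using h

/-- `∂_t ∂_x φ` along the `t`-slice. [folklore] -/
theorem hasDerivAt_dX_t (t x : ℝ) :
    HasDerivAt (fun τ ↦ dX φ (τ, x)) (d2 φ (t, x) (0, 1) (1, 0)) t := by
  have h := ((differentiable_fderiv_apply hφ (0, 1)) (t, x)).hasFDerivAt.comp_hasDerivAt t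
    (hasDerivAt_curve_t x t)
  simpa [Function.comp_def, dX, d2] using h

/-- `∂_x² φ` along the `x`-slice. [folklore] -/
theorem hasDerivAt_dX_x (t x : ℝ) :
    HasDerivAt (fun y ↦ dX φ (t, y)) (d2 φ (t, x) (0, 1) (0, 1)) x := by
  have h := ((differentiable_fderiv_apply hφ (0, 1)) (t, x)).hasFDerivAt.comp_hasDerivAt x
    (hasDerivAt_curve_x t x)
  simpa [Function.comp_def, dX, d2] using h

/-- Schwarz: the mixed second partials agree. [folklore] -/
theorem d2_symm (p v w : ℝ × ℝ) : d2 φ p v w = d2 φ p w v := by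
  have hs : IsSymmSndFDerivAt ℝ (Function.uncurry φ) p :=
    (hφ.contDiffAt).isSymmSndFDerivAt (by simp)
  have key : ∀ v w : ℝ × ℝ, d2 φ p v w = fderiv ℝ (fderiv ℝ (Function.uncurry φ)) p w v := by
    intro v w
    unfold d2
    rw [fderiv_clm_apply (((contDiff_fderiv_uncurry hφ).differentiable one_ne_zero) p)
      (differentiableAt_const v)]
    simp
  rw [key, key, hs w v]

/-- `iteratedDeriv 2` of the `t`-slice is `∂_t² φ`. [folklore] -/
theorem iteratedDeriv_two_slice_t (t x : ℝ) :
    iteratedDeriv 2 (fun τ ↦ φ τ x) t = d2 φ (t, x) (1, 0) (1, 0) := by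
  rw [show (2 : ℕ) = 1 + 1 from rfl, iteratedDeriv_succ, iteratedDeriv_one]
  have h1 : deriv (fun τ ↦ φ τ x) = fun τ ↦ dT φ (τ, x) := funext fun τ ↦ deriv_slice_t hφ τ x
  rw [h1]
  exact (hasDerivAt_dT_t hφ t x).deriv

/-- `iteratedDeriv 2` of the `x`-slice is `∂_x² φ`. [folklore] -/
theorem iteratedDeriv_two_slice_x (t x : ℝ) :
    iteratedDeriv 2 (φ t) x = d2 φ (t, x) (0, 1) (0, 1) := by
  rw [show (2 : ℕ) = 1 + 1 from rfl, iteratedDeriv_succ, iteratedDeriv_one]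
  have h1 : deriv (φ t) = fun y ↦ dX φ (t, y) := funext fun y ↦ deriv_slice_x hφ t y
  rw [h1]
  exact (hasDerivAt_dX_x hφ t x).deriv

end Slices


/-! ### A generic slice lemma for differentiable functions on `ℝ × ℝ` -/

/-- Directional derivative `(1,0)` of a differentiable function = `deriv` of its `t`-slice. [folklore] -/
theorem fderiv_apply_one_zero {G : ℝ × ℝ → ℝ} {t x : ℝ} (hG : DifferentiableAt ℝ G (t, x)) :
    fderiv ℝ G (t, x) (1, 0) = deriv (fun τ ↦ G (τ, x)) t :=
  ((hG.hasFDerivAt.comp_hasDerivAt t (hasDerivAt_curve_t x t)).deriv).symm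

/-- Directional derivative `(0,1)` of a differentiable function = `deriv` of its `x`-slice. [folklore] -/
theorem fderiv_apply_zero_one {G : ℝ × ℝ → ℝ} {t x : ℝ} (hG : DifferentiableAt ℝ G (t, x)) :
    fderiv ℝ G (t, x) (0, 1) = deriv (fun y ↦ G (t, y)) x :=
  ((hG.hasFDerivAt.comp_hasDerivAt x (hasDerivAt_curve_x t x)).deriv).symm

/-! ### The energy density and the flux as functions on `ℝ × ℝ` -/

section Energy

variable {V : ℝ → ℝ} {φ : ℝ → ℝ → ℝ}

/-- `e(t,x) = φ_t² + φ_x² + V φ²` on `ℝ × ℝ`. [folklore] -/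
def eDen (V : ℝ → ℝ) (φ : ℝ → ℝ → ℝ) (p : ℝ × ℝ) : ℝ :=
  dT φ p ^ 2 + dX φ p ^ 2 + V p.2 * (φ p.1 p.2) ^ 2

/-- The energy flux `F = 2 φ_t φ_x`. [folklore] -/
def flux (φ : ℝ → ℝ → ℝ) (p : ℝ × ℝ) : ℝ := 2 * dT φ p * dX φ p

/-- The Literature energy density `e[φ](t,x)` is `eDen V φ (t, x)` for `C²` `φ`. [cite: KenigEtAl2015, §1] -/
theorem energyDensity_eq (hφ : ContDiff ℝ 2 (Function.uncurry φ)) (t x : ℝ) :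
    energyDensity V φ t x = eDen V φ (t, x) := by
  simp [energyDensity, eDen, deriv_slice_t hφ, deriv_slice_x hφ]

/-- **Flux bound** `|2 φ_t φ_x| ≤ e` when `V ≥ 0`. [folklore] -/
theorem abs_flux_le_eDen (hV : ∀ x, 0 ≤ V x) (p : ℝ × ℝ) : |flux φ p| ≤ eDen V φ p := by
  unfold flux eDen
  have h3 : 0 ≤ V p.2 * (φ p.1 p.2) ^ 2 := mul_nonneg (hV _) (sq_nonneg _)
  rw [abs_le]
  constructor
  · nlinarith [sq_nonneg (dT φ p + dX φ p)]
  · nlinarith [sq_nonneg (dT φ p - dX φ p)]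

/-- The energy density is nonnegative when `V ≥ 0`. [folklore] -/
theorem eDen_nonneg (hV : ∀ x, 0 ≤ V x) (p : ℝ × ℝ) : 0 ≤ eDen V φ p :=
  (abs_nonneg _).trans (abs_flux_le_eDen hV p)

variable (hφ : ContDiff ℝ 2 (Function.uncurry φ))
include hφ

/-- `∂_t φ ∈ C¹`. [folklore] -/
theorem contDiff_dT : ContDiff ℝ 1 (dT φ) := (contDiff_fderiv_uncurry hφ).clm_apply contDiff_const
/-- `∂_x φ ∈ C¹`. [folklore] -/
theorem contDiff_dX : ContDiff ℝ 1 (dX φ) := (contDiff_fderiv_uncurry hφ).clm_apply contDiff_const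

/-- The flux is `C¹`. [folklore] -/
theorem contDiff_flux : ContDiff ℝ 1 (flux φ) := by
  unfold flux
  exact (contDiff_const.mul (contDiff_dT hφ)).mul (contDiff_dX hφ)

/-- The energy density is `C¹` when `V ∈ C¹`. [folklore] -/
theorem contDiff_eDen (hV : ContDiff ℝ 1 V) : ContDiff ℝ 1 (eDen V φ) := by
  unfold eDen
  have hu : ContDiff ℝ 1 (fun p : ℝ × ℝ ↦ φ p.1 p.2) := hφ.of_le (by norm_num)
  exact (((contDiff_dT hφ).pow 2).add ((contDiff_dX hφ).pow 2)).add
    ((hV.comp contDiff_snd).mul (hu.pow 2))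

/-- `∂_t e` along the `t`-slice. [folklore] -/
theorem hasDerivAt_eDen_t (t x : ℝ) :
    HasDerivAt (fun τ ↦ eDen V φ (τ, x))
      (2 * dT φ (t, x) * d2 φ (t, x) (1, 0) (1, 0) + 2 * dX φ (t, x) * d2 φ (t, x) (0, 1) (1, 0)
        + V x * (2 * φ t x * dT φ (t, x))) t := by
  have h1 := (hasDerivAt_dT_t hφ t x).fun_pow 2
  have h2 := (hasDerivAt_dX_t hφ t x).fun_pow 2
  have h3 := ((hasDerivAt_slice_t hφ t x).fun_pow 2).const_mul (V x)
  have h := (h1.fun_add h2).fun_add h3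
  refine (h.congr_deriv ?_).congr_of_eventuallyEq (Filter.Eventually.of_forall fun τ ↦ rfl)
  norm_num

/-- `∂_x F` along the `x`-slice. [folklore] -/
theorem hasDerivAt_flux_x (t x : ℝ) :
    HasDerivAt (fun y ↦ flux φ (t, y))
      (2 * (d2 φ (t, x) (1, 0) (0, 1) * dX φ (t, x) + dT φ (t, x) * d2 φ (t, x) (0, 1) (0, 1))) x := by
  have h := ((hasDerivAt_dT_x hφ t x).fun_mul (hasDerivAt_dX_x hφ t x)).const_mul 2
  refine (h.congr_deriv ?_).congr_of_eventuallyEq (Filter.Eventually.of_forall fun y ↦ ?_)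
  · ring
  · simp only [flux]; ring

/-- **The local conservation law** `∂_t e = ∂_x F` for `C²` solutions of `φ_tt − φ_xx + Vφ = 0`
(directional `fderiv`s of the `C¹` functions `eDen`, `flux`). [folklore] -/
theorem fderiv_eDen_eq_fderiv_flux (hV : ContDiff ℝ 1 V) (hsol : ∀ z, IsSolutionAt V φ z)
    (p : ℝ × ℝ) : fderiv ℝ (eDen V φ) p (1, 0) = fderiv ℝ (flux φ) p (0, 1) := by
  obtain ⟨t, x⟩ := p
  have hde : DifferentiableAt ℝ (eDen V φ) (t, x) :=
    ((contDiff_eDen hφ hV).differentiable one_ne_zero) (t, x)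
  have hdf : DifferentiableAt ℝ (flux φ) (t, x) :=
    ((contDiff_flux hφ).differentiable one_ne_zero) (t, x)
  rw [fderiv_apply_one_zero hde, fderiv_apply_zero_one hdf, (hasDerivAt_eDen_t hφ t x).deriv,
    (hasDerivAt_flux_x hφ t x).deriv]
  have hpde := hsol (t, x)
  unfold IsSolutionAt at hpde
  rw [iteratedDeriv_two_slice_t hφ, iteratedDeriv_two_slice_x hφ] at hpde
  have hsym : d2 φ (t, x) (0, 1) (1, 0) = d2 φ (t, x) (1, 0) (0, 1) := d2_symm hφ _ _ _
  rw [hsym]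
  have : d2 φ (t, x) (1, 0) (1, 0) = d2 φ (t, x) (0, 1) (0, 1) - V x * φ t x := by
    simp only at hpde; linarith
  rw [this]
  ring

end Energy


end Summit.FinalStateConjecture.FinalStateConjecture.Theorems.ChannelsResolveTameDevelopments.Negative

end
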